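import Literature.AlgebraicGeometry.Motives.AbelianVarietyQuotientPoints
import HarnessLib

/-!
# The quotient `P/S`: descent of the action `P × P/S → P/S`

Continuation of `AbelianVarietyQuotientPoints`. The group law `μ ≫ h : P ×_K P → P/S` is
descended along the effective epimorphism `P ×_K h : P ×_K P → P ×_K P/S` (fpqc descent of
morphisms, Mathlib `EffectiveEpi.desc` for flat surjective quasi-compact morphisms):

* `kerPairOver`, `kerPairFst`, `kerPairSnd`: the kernel pair `R₀ = P ×_{P/S} P` over `K`;
  `isReduced_tensorObj_kerPairOver_left`: `P ×_K R₀` is reduced (`P` geometrically reduced,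
  `R₀` reduced, Mathlib);
* `whiskerLeft_kerPairFst_mul_quotientMapOver` (**key equation**): `μ ≫ h` coequalises
  `P × p₁, P × p₂ : P ×_K R₀ ⇉ P ×_K P` — checked on residue-field points of the reduced source
  into the separated target (Mathlib `ext_of_fromSpecResidueField_eq`), where it is
  `mul_comp_quotientMapOver_eq`;
* `actDesc_cond`, `quotAct`, `whiskerLeft_quotAct`: the descended action
  `act : P ×_K P/S → P/S` with `(P × h) ≫ act = μ ≫ h`.

Mumford, *Abelian Varieties*, §7 Thm. 4 (p. 72), §12 Thm. 1; Görtz–Wedhorn II, Thm. 27.68.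

## References

* [MumfordAV1970] D. Mumford, *Abelian Varieties*, §7 Thm. 4 (p. 72), §12.
* [Kieffer2024IsogenyGraphs] J. Kieffer, Prop. 1.1.10 (p. 10).
-/

noncomputable section

universe u

open CategoryTheory CategoryTheory.Limits AlgebraicGeometry

namespace Literature.AlgebraicGeometry.Motives

namespace AbelianVariety

open scoped MonObj Obj
open Literature.AlgebraicGeometry.RelativeSpec Literature.AlgebraicGeometry.Morphisms
open MonoidalCategory CartesianMonoidalCategory TensorProduct

variable {K : Type u} [Field K] (L : Type u) [Field L] [Algebra K L] (P : AbelianVariety K)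
variable (S : Subgroup (P.Points L))
  (hS : ∀ (σ : L ≃ₐ[K] L) (s : P.Points L), s ∈ S → σ • s ∈ S)
  (q : P ⟶ P) (hSq : ∀ s ∈ S, s ≫ q.hom.hom.hom = 1)

variable [FiniteDimensional K L] [IsGalois K L] [Finite S] [IsAffineHom (Hom.toSchemeHom q)]

/-! ### The kernel pair of `h` over `K` -/

/-- `R₀ = P ×_{P/S} P` as a `K`-scheme. [folklore] -/
abbrev kerPairOver : SchemeOver K :=
  Over.mk (pullback.fst (P.quotientMap L S hS q hSq) (P.quotientMap L S hS q hSq) ≫ P.X.hom)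

/-- The first projection `R₀ → P` over `K`. [folklore] -/
abbrev kerPairFst : P.kerPairOver L S hS q hSq ⟶ P.X :=
  Over.homMk (pullback.fst (P.quotientMap L S hS q hSq) (P.quotientMap L S hS q hSq)) rfl

/-- The second projection `R₀ → P` is over `K`. [folklore] -/
theorem kerPair_snd_comp_hom :
    pullback.snd (P.quotientMap L S hS q hSq) (P.quotientMap L S hS q hSq) ≫ P.X.hom =
      pullback.fst (P.quotientMap L S hS q hSq) (P.quotientMap L S hS q hSq) ≫ P.X.hom :=
  calc pullback.snd (P.quotientMap L S hS q hSq) (P.quotientMap L S hS q hSq) ≫ P.X.hom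
      = pullback.snd (P.quotientMap L S hS q hSq) (P.quotientMap L S hS q hSq) ≫
          P.quotientMap L S hS q hSq ≫ (P.quotOver L S hS q hSq).hom := by
        rw [quotientMap_comp_hom]
    _ = pullback.fst (P.quotientMap L S hS q hSq) (P.quotientMap L S hS q hSq) ≫
          P.quotientMap L S hS q hSq ≫ (P.quotOver L S hS q hSq).hom := by
        rw [pullback.condition_assoc]
    _ = _ := by rw [quotientMap_comp_hom]

/-- `P/S → Spec K` is separated (`P/S → P` is affine, `P → Spec K` is separated). [folklore] -/
instance isSeparated_quotOver_hom : IsSeparated (P.quotOver L S hS q hSq).hom := by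
  change IsSeparated ((P.quotAction L S hS q hSq).quotientToBase ≫ P.X.hom)
  infer_instance

/-- The second projection `R₀ → P` over `K`. [folklore] -/
abbrev kerPairSnd : P.kerPairOver L S hS q hSq ⟶ P.X :=
  Over.homMk (pullback.snd (P.quotientMap L S hS q hSq) (P.quotientMap L S hS q hSq))
    (P.kerPair_snd_comp_hom L S hS q hSq)

/-- `p₁ ≫ h = p₂ ≫ h` on `R₀`. [folklore] -/
theorem kerPairFst_comp_quotientMapOver :
    P.kerPairFst L S hS q hSq ≫ P.quotientMapOver L S hS q hSq =
      P.kerPairSnd L S hS q hSq ≫ P.quotientMapOver L S hS q hSq :=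
  Over.OverMorphism.ext pullback.condition

/-- `h` is locally of finite type (`h ≫ (P/S → Spec K) = (P → Spec K)` is). [folklore] -/
instance locallyOfFiniteType_quotientMap : LocallyOfFiniteType (P.quotientMap L S hS q hSq) := by
  have : LocallyOfFiniteType (P.quotientMap L S hS q hSq ≫ (P.quotOver L S hS q hSq).hom) := by
    rw [quotientMap_comp_hom]
    infer_instance
  exact locallyOfFiniteType_of_comp _ (P.quotOver L S hS q hSq).hom

/-- **`P ×_K R₀` is reduced** (`P` geometrically reduced and flat over `K`, `R₀` reduced and
locally noetherian; Mathlib). [folklore] -/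
instance isReduced_tensorObj_kerPairOver_left :
    IsReduced (P.X ⊗ P.kerPairOver L S hS q hSq).left := by
  haveI := P.isReduced_pullback_quotientMap L S hS q hSq
  change IsReduced (pullback P.X.hom
    (pullback.fst (P.quotientMap L S hS q hSq) (P.quotientMap L S hS q hSq) ≫ P.X.hom))
  infer_instance

/-- **The key equation on the kernel pair**: `μ ≫ h` coequalises `P × p₁, P × p₂ : P ×_K R₀ ⇉
P ×_K P`. Both sides are morphisms from the reduced `P ×_K R₀` to the separated `P/S` over `K`,
so it suffices to compare them on residue-field points (Mathlib `ext_of_fromSpecResidueField_eq`),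
where it is `mul_comp_quotientMapOver_eq`. [cite: MumfordAV1970, §7 Thm. 4 p. 72] -/
theorem whiskerLeft_kerPairFst_mul_quotientMapOver :
    (P.X ◁ P.kerPairFst L S hS q hSq) ≫ μ ≫ P.quotientMapOver L S hS q hSq =
      (P.X ◁ P.kerPairSnd L S hS q hSq) ≫ μ ≫ P.quotientMapOver L S hS q hSq := by
  apply Over.OverMorphism.ext
  refine ext_of_fromSpecResidueField_eq _ _ (P.quotOver L S hS q hSq).hom Set.univ dense_univ
    ?_ ?_
  · intro x _
    let t := (P.X ⊗ P.kerPairOver L S hS q hSq).left.fromSpecResidueField x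
    let tO : Over.mk (t ≫ (P.X ⊗ P.kerPairOver L S hS q hSq).hom) ⟶
        P.X ⊗ P.kerPairOver L S hS q hSq := Over.homMk t rfl
    have e' : ∀ k : P.kerPairOver L S hS q hSq ⟶ P.X,
        tO ≫ (P.X ◁ k) = lift (tO ≫ fst _ _) (tO ≫ snd _ _ ≫ k) := fun k ↦ by
      ext <;> simp
    have e : ∀ k : P.kerPairOver L S hS q hSq ⟶ P.X,
        t ≫ ((P.X ◁ k) ≫ μ ≫ P.quotientMapOver L S hS q hSq).left =
          (((tO ≫ fst _ _) * (tO ≫ snd _ _ ≫ k)) ≫ P.quotientMapOver L S hS q hSq).left := by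
      intro k
      change (tO ≫ (P.X ◁ k) ≫ μ ≫ P.quotientMapOver L S hS q hSq).left = _
      rw [← Category.assoc tO (P.X ◁ k), e' k, Hom.mul_def, Category.assoc]
    have hk : (tO ≫ snd _ _ ≫ P.kerPairFst L S hS q hSq) ≫ P.quotientMapOver L S hS q hSq =
        (tO ≫ snd _ _ ≫ P.kerPairSnd L S hS q hSq) ≫ P.quotientMapOver L S hS q hSq := by
      simp only [Category.assoc, kerPairFst_comp_quotientMapOver]
    have key := P.mul_comp_quotientMapOver_eq L S hS q hSq _ (tO ≫ fst _ _)
      (tO ≫ snd _ _ ≫ P.kerPairFst L S hS q hSq) (tO ≫ snd _ _ ≫ P.kerPairSnd L S hS q hSq) hk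
    rw [e, e]
    exact congrArg CommaMorphism.left key
  · rw [Over.w, Over.w]

/-! ### Descent of the action `P × P/S → P/S` -/

/-- The descent datum for the action: `μ ≫ h : P ×_K P → P/S` coequalises the kernel pair of
`P ×_K h` (a pair `g₁, g₂` with `g₁ ≫ (P × h) = g₂ ≫ (P × h)` factors through
`P × p₁, P × p₂ : P ×_K R₀ ⇉ P ×_K P`). [folklore] -/
theorem actDesc_cond {Z : Scheme.{u}} (g₁ g₂ : Z ⟶ (P.X ⊗ P.X).left)
    (hg : g₁ ≫ (P.X ◁ P.quotientMapOver L S hS q hSq).left =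
      g₂ ≫ (P.X ◁ P.quotientMapOver L S hS q hSq).left) :
    g₁ ≫ (μ ≫ P.quotientMapOver L S hS q hSq).left =
      g₂ ≫ (μ ≫ P.quotientMapOver L S hS q hSq).left := by
  -- pass to `K`-morphisms
  let ZO : SchemeOver K := Over.mk (g₁ ≫ (P.X ⊗ P.X).hom)
  let G₁ : ZO ⟶ P.X ⊗ P.X := Over.homMk g₁ rfl
  have hw₂ : g₂ ≫ (P.X ⊗ P.X).hom = g₁ ≫ (P.X ⊗ P.X).hom := by
    rw [← Over.w (P.X ◁ P.quotientMapOver L S hS q hSq), ← Category.assoc, ← hg, Category.assoc]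
  let G₂ : ZO ⟶ P.X ⊗ P.X := Over.homMk g₂ hw₂
  have hG : G₁ ≫ (P.X ◁ P.quotientMapOver L S hS q hSq) =
      G₂ ≫ (P.X ◁ P.quotientMapOver L S hS q hSq) := Over.OverMorphism.ext hg
  have h1 : G₁ ≫ fst _ _ = G₂ ≫ fst _ _ := by
    simpa only [Category.assoc, whiskerLeft_fst] using congrArg (· ≫ fst _ _) hG
  have h2 : (G₁ ≫ snd _ _) ≫ P.quotientMapOver L S hS q hSq =
      (G₂ ≫ snd _ _) ≫ P.quotientMapOver L S hS q hSq := by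
    simpa only [Category.assoc, whiskerLeft_snd] using congrArg (· ≫ snd _ _) hG
  -- the factorisation through `P ×_K R₀`
  let rO : ZO ⟶ P.kerPairOver L S hS q hSq :=
    Over.homMk (pullback.lift (G₁ ≫ snd _ _).left (G₂ ≫ snd _ _).left
      (congrArg CommaMorphism.left h2)) (by
        change pullback.lift _ _ _ ≫ pullback.fst _ _ ≫ P.X.hom = _
        rw [pullback.lift_fst_assoc]
        exact Over.w (G₁ ≫ snd _ _))
  have hr₁ : rO ≫ P.kerPairFst L S hS q hSq = G₁ ≫ snd _ _ :=
    Over.OverMorphism.ext (pullback.lift_fst _ _ _)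
  have hr₂ : rO ≫ P.kerPairSnd L S hS q hSq = G₂ ≫ snd _ _ :=
    Over.OverMorphism.ext (pullback.lift_snd _ _ _)
  have hz₁ : lift (G₁ ≫ fst _ _) rO ≫ (P.X ◁ P.kerPairFst L S hS q hSq) = G₁ := by
    rw [lift_whiskerLeft, hr₁, lift_comp_fst_snd]
  have hz₂ : lift (G₁ ≫ fst _ _) rO ≫ (P.X ◁ P.kerPairSnd L S hS q hSq) = G₂ := by
    rw [lift_whiskerLeft, hr₂, h1, lift_comp_fst_snd]
  change (G₁ ≫ μ ≫ P.quotientMapOver L S hS q hSq).left =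
    (G₂ ≫ μ ≫ P.quotientMapOver L S hS q hSq).left
  rw [← hz₁, ← hz₂, Category.assoc, Category.assoc, whiskerLeft_kerPairFst_mul_quotientMapOver]

/-- `P ×_K h` is flat (so, being also surjective and quasi-compact, an effective epimorphism
of schemes). [folklore] -/
instance flat_whiskerLeft_quotientMapOver_left :
    Flat (P.X ◁ P.quotientMapOver L S hS q hSq).left :=
  whiskerLeft_left_mem @Flat _ inferInstance

/-- `P ×_K h` is surjective. [folklore] -/
instance surjective_whiskerLeft_quotientMapOver_left :
    Surjective (P.X ◁ P.quotientMapOver L S hS q hSq).left :=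
  whiskerLeft_left_mem @Surjective _ inferInstance

/-- `P ×_K h` is quasi-compact. [folklore] -/
instance quasiCompact_whiskerLeft_quotientMapOver_left :
    QuasiCompact (P.X ◁ P.quotientMapOver L S hS q hSq).left :=
  whiskerLeft_left_mem @QuasiCompact _ inferInstance

/-- **The action `P ×_K P/S → P/S`** induced by the group law of `P`: the descent of
`μ ≫ h : P ×_K P → P/S` along the effective epimorphism `P ×_K h` (fpqc descent of morphisms,
Mathlib `EffectiveEpi.desc`; Mumford, *Abelian Varieties*, §7 Thm. 4, §12). [cite: MumfordAV1970, §7 Thm. 4 p. 72] -/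
def quotAct : P.X ⊗ P.quotOver L S hS q hSq ⟶ P.quotOver L S hS q hSq :=
  Over.homMk (EffectiveEpi.desc (P.X ◁ P.quotientMapOver L S hS q hSq).left
    (μ ≫ P.quotientMapOver L S hS q hSq).left
    (fun g₁ g₂ hg ↦ P.actDesc_cond L S hS q hSq g₁ g₂ hg)) (by
      rw [← cancel_epi (P.X ◁ P.quotientMapOver L S hS q hSq).left, EffectiveEpi.fac_assoc,
        Over.w, Over.w])

/-- The defining property of the action: `(P × h) ≫ act = μ ≫ h`. [folklore] -/
@[reassoc]
theorem whiskerLeft_quotAct :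
    (P.X ◁ P.quotientMapOver L S hS q hSq) ≫ P.quotAct L S hS q hSq =
      μ ≫ P.quotientMapOver L S hS q hSq :=
  Over.OverMorphism.ext (EffectiveEpi.fac (P.X ◁ P.quotientMapOver L S hS q hSq).left
    (μ ≫ P.quotientMapOver L S hS q hSq).left (fun g₁ g₂ hg ↦ P.actDesc_cond L S hS q hSq g₁ g₂ hg))


end AbelianVariety

end Literature.AlgebraicGeometry.Motives
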